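import Literature.NumberTheory.DiophantineGeometry.GenEllPrimesPrescribed
import Literature.NumberTheory.EllipticCurves.BSDSelmerPConverseSerreProofs
import Literature.NumberTheory.GaloisRepresentations.ArtinLemmaCyclotomic
import Literature.NumberTheory.GaloisRepresentations.ModNCyclotomicCharacter
import HarnessLib

/-!
# [GenEll] Cor. 4.3, proof, first paragraph: `SL₂ ⊆ Im ⟹ surjective` for `l` unramified in `L`

S. Mochizuki, *Arithmetic elliptic curves in general position*, Math. J. Okayama Univ. 52 (2010)
[cite: MochizukiGenEll2010], proof of Corollary 4.3, p. 22, read on the page: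

> First, let us observe that if `E_L` is as in the statement of Corollary 4.3, and `l` is any prime
> number that is unramified in `L`, then the image of the Galois representation
> `Gal(Q̄/L) → GL₂(ℤ_l)` associated to `E_L` contains `SL₂(ℤ_l)` if and only if the Galois
> representation `Gal(Q̄/L) → GL₂(ℤ_l)` is surjective. [Indeed, this follows immediately from the
> well-known fact that the field extension `ℚ(ζ_{l^∞})/ℚ` obtained by adjoining the `l`-th power
> roots of unity to `ℚ` is totally ramified over the prime `l`, hence linearly disjoint from the
> extension `L/ℚ`.]

Topic `NumberTheory/DiophantineGeometry`.  Theorem-only file (no definition, no named fact),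
proving this level by level in the vocabulary of `GenEllPrimesPrescribed.lean`:

* `modNCyclotomicCharacter_surjective_of_forall_prime_dvd_not_dvd_discr` — for a number field `F`
  and `m ≥ 1` whose prime divisors do not divide `d_F`, the mod-`m` cyclotomic character
  `Γ_F → (ℤ/m)ˣ` is surjective (the tree's `cycloChar_bijective_of_forall_prime_dvd_not_dvd_discr`,
  i.e. `[F(ζ_m) : F] = φ(m)` by linear disjointness, lifted to `Γ_F`);
* `GenEll.EllPoint.lAdicImageSurjective_of_containsSL2` — for a presented elliptic curve `E/L` and
  a prime `l` prime to the ramification data of `L`: `SL₂`-containment of the image in `Aut(E[l^n])`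
  for all `n ≥ 1` (`EllPoint.LAdicImageContainsSL2`) implies surjectivity of every mod-`l^n`
  representation (`EllPoint.LAdicImageSurjective`), using `det ρ̄_{E,m} = χ_m` (tree theorem
  `Literature.NumberTheory.EllipticCurves.det_eq_modNCyclotomicCharacter`, from the Weil pairing).

## References

* S. Mochizuki, op. cit., proof of Cor. 4.3, p. 22. [MochizukiGenEll2010]
* J. H. Silverman, in Cornell–Silverman–Stevens (1997), Ch. II §7 (`det ρ̄_m = χ_m`).
  [SilvermanCSS1997]
-/

noncomputable section

open scoped Classical MatrixGroups

open NumberField WeierstrassCurve Matrix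

namespace Literature.NumberTheory.GaloisRepresentations

/-- **The mod-`m` cyclotomic character of `Γ_F` is surjective when the primes of `m` are unramified
in `F`**: for a number field `F` and `m ≥ 1` such that no prime dividing `m` divides `d_F`, every
unit `u mod m` is `χ_m(τ)` for some `τ ∈ Γ_F` (`Gal(F(ζ_m)/F) ≅ (ℤ/m)ˣ` by
`cycloChar_bijective_of_forall_prime_dvd_not_dvd_discr`, and automorphisms of `F(ζ_m) ⊆ F̄` lift to
`F̄`). [cite: MochizukiGenEll2010, proof of Cor. 4.3, p. 22] -/
theorem modNCyclotomicCharacter_surjective_of_forall_prime_dvd_not_dvd_discr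
    (F : Type*) [Field F] [NumberField F] (m : ℕ) [NeZero m]
    (hcop : ∀ p : ℕ, p.Prime → p ∣ m → ¬ ((p : ℤ) ∣ NumberField.discr F)) :
    Function.Surjective (modNCyclotomicCharacter F m) := by
  intro u
  -- a primitive `m`-th root of unity in `F̄` and the number field `N = F(ζ) ⊆ F̄`
  obtain ⟨ζ, hζ⟩ := HasEnoughRootsOfUnity.exists_primitiveRoot (AlgebraicClosure F) m
  set N : IntermediateField F (AlgebraicClosure F) := IntermediateField.adjoin F {ζ} with hN
  haveI : IsCyclotomicExtension {m} F N := hζ.intermediateField_adjoin_isCyclotomicExtension F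
  haveI : NumberField N := IsCyclotomicExtension.numberField {m} F N
  -- `Gal(N/F) ≅ (ℤ/m)ˣ`
  obtain ⟨g, hg⟩ := (cycloChar_bijective_of_forall_prime_dvd_not_dvd_discr F N m hcop).2 u
  -- lift `g` to `Γ_F`
  set τ : Field.absoluteGaloisGroup F := g.liftNormal (AlgebraicClosure F) with hτ
  refine ⟨τ, ?_⟩
  have hz := IsCyclotomicExtension.zeta_spec m F N
  set z : N := IsCyclotomicExtension.zeta m F N with hzdef
  have hZ : IsPrimitiveRoot ((z : N) : AlgebraicClosure F) m :=
    hz.map_of_injective (algebraMap N (AlgebraicClosure F)).injective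
  have hτz : τ • ((z : N) : AlgebraicClosure F) =
      ((z : N) : AlgebraicClosure F) ^ ((u : (ZMod m)ˣ) : ZMod m).val := by
    change (g.liftNormal (AlgebraicClosure F)) (algebraMap N (AlgebraicClosure F) z) = _
    rw [AlgEquiv.liftNormal_commutes, cycloChar_spec F N m g, hg]
    rfl
  have h := modNCyclotomicCharacter_eq_of_smul_eq_pow F m hZ τ hτz
  exact Units.ext (by rw [h, ZMod.natCast_zmod_val])

end Literature.NumberTheory.GaloisRepresentations

namespace Literature.NumberTheory.DiophantineGeometry.GenEll

namespace EllPoint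

open Literature.NumberTheory.EllipticCurves Literature.NumberTheory.GaloisRepresentations

/-- Two `2 × 2` matrices acting identically on all vectors are equal. [folklore] -/
private theorem matrix_eq_of_mulVec_eq {R : Type*} [CommRing R] {A B : Matrix (Fin 2) (Fin 2) R}
    (h : ∀ v, A *ᵥ v = B *ᵥ v) : A = B :=
  Matrix.toLin'.injective (LinearMap.ext h)

/-- **[GenEll] Cor. 4.3, proof, first paragraph**: for a presented elliptic curve `E/L` and a prime
`l` prime to the ramification data of `L` (`l ∤ d_L`), if the image of `Gal(Q̄/L)` in `Aut(E[l^n])`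
contains `SL₂` for every `n ≥ 1`, then every mod-`l^n` Galois representation of `E` is surjective:
`det ρ̄_{E,l^n} = χ_{l^n}` (Weil pairing) is onto `(ℤ/l^n)ˣ` because `l` is unramified in `L`
("`ℚ(ζ_{l^∞})/ℚ` … is totally ramified over the prime `l`, hence linearly disjoint from the
extension `L/ℚ`"), and `GL₂ = SL₂ · (image of det)`. [cite: MochizukiGenEll2010, proof of Cor. 4.3, p. 22] -/
theorem lAdicImageSurjective_of_containsSL2 (P : EllPoint) (l : ℕ) [Fact l.Prime]
    (hram : P.PrimeToRamificationData l) (hSL : P.LAdicImageContainsSL2 l) :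
    P.LAdicImageSurjective l := by
  intro n hn
  have hl : l.Prime := Fact.out
  obtain ⟨k, rfl⟩ : ∃ k, n = k + 1 := ⟨n - 1, by omega⟩
  have hlF : (l : P.F) ≠ 0 := Nat.cast_ne_zero.mpr hl.ne_zero
  haveI : NeZero (l ^ (k + 1)) := ⟨pow_ne_zero _ hl.ne_zero⟩
  haveI : NeZero ((l ^ (k + 1) : ℕ) : P.F) := ⟨by exact_mod_cast pow_ne_zero (k + 1) hlF⟩
  have hm2 : 2 ≤ l ^ (k + 1) := hl.two_le.trans (Nat.le_self_pow k.succ_ne_zero l)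
  -- a frame of `E[l^(k+1)]` and the framed representation
  obtain ⟨e⟩ := nonempty_addEquiv_geomTorsion P.W l (k + 1) k.succ_pos hlF
  obtain ⟨ρ, hρ⟩ := exists_rep_of_addEquiv P.W e
  -- (1) the determinant is onto: `χ_{l^(k+1)}` is surjective on `Γ_L`
  have hcop : ∀ p : ℕ, p.Prime → p ∣ l ^ (k + 1) → ¬ ((p : ℤ) ∣ NumberField.discr P.F) := by
    intro p hp hpd
    rw [(Nat.prime_dvd_prime_iff_eq hp hl).mp (hp.dvd_of_dvd_pow hpd)]
    exact hram.1
  have hdet : ∀ u : (ZMod (l ^ (k + 1)))ˣ, ∃ σ : Field.absoluteGaloisGroup P.F,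
      Matrix.GeneralLinearGroup.det (ρ σ) = u := by
    intro u
    obtain ⟨σ, hσ⟩ :=
      modNCyclotomicCharacter_surjective_of_forall_prime_dvd_not_dvd_discr P.F (l ^ (k + 1)) hcop u
    refine ⟨σ, Units.ext ?_⟩
    rw [Matrix.GeneralLinearGroup.val_det_apply, ← hσ]
    exact det_eq_modNCyclotomicCharacter P.W (l ^ (k + 1)) hm2 e σ _ (hρ σ)
  -- (2) `SL₂ ⊆ range ρ`, from `ImageModLContainsSL2`
  letI inst : Module (ZMod (l ^ (k + 1))) (P.W.geomTorsion ((l ^ (k + 1) : ℕ) : ℤ)) :=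
    AddSubgroup.torsionBy.zmodModule
  -- the frame as a `ℤ/l^(k+1)`-linear equivalence
  set ε : P.W.geomTorsion ((l ^ (k + 1) : ℕ) : ℤ) ≃ₗ[ZMod (l ^ (k + 1))]
      (Fin 2 → ZMod (l ^ (k + 1))) :=
    { e.toAddMonoidHom.toZModLinearMap (l ^ (k + 1)) with
      invFun := e.symm
      left_inv := fun x => e.symm_apply_apply x
      right_inv := fun x => e.apply_symm_apply x } with hε
  have hεe : ∀ x, ε x = e x := fun x => rfl
  have hεs : ∀ v, ε.symm v = e.symm v := fun v => rfl
  have hSL1 : ∀ B : GL (Fin 2) (ZMod (l ^ (k + 1))), Matrix.GeneralLinearGroup.det B = 1 →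
      B ∈ ρ.range := by
    intro B hB
    -- the linear endomorphism of `E[m]` with matrix `B` in the frame
    set f : P.W.geomTorsion ((l ^ (k + 1) : ℕ) : ℤ) →ₗ[ZMod (l ^ (k + 1))]
        P.W.geomTorsion ((l ^ (k + 1) : ℕ) : ℤ) :=
      (ε.symm : _ →ₗ[ZMod (l ^ (k + 1))] _) ∘ₗ Matrix.toLin' (B : Matrix (Fin 2) (Fin 2) _) ∘ₗ
        (ε : _ →ₗ[ZMod (l ^ (k + 1))] _) with hf
    have hfdet : LinearMap.det f = 1 := by
      have h1 : LinearMap.det f = LinearMap.det (Matrix.toLin' (B : Matrix (Fin 2) (Fin 2) _)) := by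
        rw [hf, ← LinearMap.det_conj (Matrix.toLin' (B : Matrix (Fin 2) (Fin 2) _)) ε.symm]
        rfl
      rw [h1, LinearMap.det_toLin', ← Matrix.GeneralLinearGroup.val_det_apply, hB, Units.val_one]
    have hfe : ∀ x, e (f x) = (B : Matrix (Fin 2) (Fin 2) _) *ᵥ e x := by
      intro x
      rw [hf]
      simp only [LinearMap.coe_comp, LinearEquiv.coe_coe, Function.comp_apply, Matrix.toLin'_apply,
        hεe, hεs, e.apply_symm_apply]
    obtain ⟨σ, hσ⟩ := hSL (k + 1) k.succ_pos f hfdet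
    refine ⟨σ, ?_⟩
    apply Units.ext
    refine matrix_eq_of_mulVec_eq fun v => ?_
    have h1 := hρ σ (e.symm v)
    rw [hσ, hfe, e.apply_symm_apply] at h1
    exact h1.symm
  -- (3) `range ρ = GL₂`
  have htop : ∀ B : GL (Fin 2) (ZMod (l ^ (k + 1))), B ∈ ρ.range := by
    intro B
    obtain ⟨τ, hτ⟩ := hdet (Matrix.GeneralLinearGroup.det B)
    have h1 : Matrix.GeneralLinearGroup.det (B * (ρ τ)⁻¹) = 1 := by
      rw [map_mul, map_inv, hτ, mul_inv_cancel]
    obtain ⟨σ, hσ⟩ := hSL1 _ h1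
    refine ⟨σ * τ, ?_⟩
    rw [map_mul, hσ, inv_mul_cancel_right]
  -- conclusion: every additive automorphism of `E[l^(k+1)]` is some `σ`
  intro y
  obtain ⟨Φ, hΦ⟩ := exists_matrix_of_addEquiv e
  obtain ⟨B, hB⟩ := exists_generalLinearGroup_of_addEquiv Φ (Multiplicative.toAdd y)
  obtain ⟨σ, hσ⟩ := htop B
  refine ⟨σ, Multiplicative.toAdd.injective (AddEquiv.ext fun Q ↦ e.injective ?_)⟩
  rw [galoisRepTorsion_apply, hρ σ Q, hσ, hB]
  exact (hΦ _ Q).symm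

end EllPoint

end Literature.NumberTheory.DiophantineGeometry.GenEll
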